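import Literature.NumberTheory.Automorphic.LeviEmbeddingGL
import Literature.NumberTheory.Automorphic.AdelicHeightGLProofs
import Literature.NumberTheory.Automorphic.AdelicHeightGLSiegel
import HarnessLib

/-!
# The adelic height on the Levi factors of the maximal parabolic of `GL_{k+l}`
(Borel–Jacquet 1979, §1.2; Moeglin–Waldspurger 1995, I.2.2)

Topic `NumberTheory/Automorphic`; sequel of `LeviEmbeddingGL`. The adelic height
`‖g‖ = H_∞(g) ∏_v H_v(g)` of `AdelicGLnGlue` (`H = max` over the entries of `g` and `g⁻¹` of the
local norms) is compared along the embeddings `m ↦ diag(m, 1)` and `m ↦ diag(1, m)` of the two Levi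
factors `GL_k(𝔸_K)`, `GL_l(𝔸_K)` into `GL_{k+l}(𝔸_K)`: the entries of `diag(m, 1)^{±1}` are those of
`m^{±1}` together with `0`'s and `1`'s, so

* `GLn.archHeight_leviGL_inl_le`, `GLn.localHeight_leviGL_inl_le` (and `_inr`) —
  `H_∞(diag(m, 1)) ≤ H_∞(m) ⊔ 1`, `H_v(diag(m, 1)) ≤ H_v(m)`;
* `GLn.one_le_mul_archHeight_sq` — **`1 ≤ n H_∞(g)²`** for `g ∈ GL_n(𝔸_K)`, `n ≥ 1`
  (`1 = ‖∑_j g_{1j} (g⁻¹)_{j1}‖`), the lower bound making `H_∞ ⊔ 1` comparable to `H_∞`;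
* **`one_sup_adelicHeightGL_leviGL_inl_le`** — `1 ⊔ ‖diag(m, 1)‖ ≤ k (1 ⊔ ‖m‖)` for
  `m ∈ GL_k(𝔸_K)`, `k ≥ 1`, and `one_sup_adelicHeightGL_leviGL_inr_le` —
  `1 ⊔ ‖diag(1, m)‖ ≤ l (1 ⊔ ‖m‖)`; with the submultiplicativity `one_sup_adelicHeightGL_mul_le` of
  the tree this bounds `1 ⊔ ‖diag(m₁, m₂)‖` polynomially in `1 ⊔ ‖m₁‖`, `1 ⊔ ‖m₂‖`
  (`one_sup_adelicHeightGL_leviGL_le`) — the input for the moderate growth of the restrictions of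
  constant terms to the Levi in Harish-Chandra's finiteness theorem (Borel–Jacquet 1979, 4.3–4.4).

Everything here is proved; no definitions.

## References

* A. Borel, H. Jacquet, *Automorphic forms and automorphic representations* (1979), §1.2, 4.4
  [BorelJacquet1979].
* C. Moeglin, J.-L. Waldspurger, *Spectral decomposition and Eisenstein series* (1995), I.2.2
  [MoeglinWaldspurger1995].
-/

noncomputable section

open scoped Matrix MatrixGroups NNReal Classical
open NumberField IsDedekindDomain NumberField.mixedEmbedding

namespace Literature.NumberTheory.Automorphic

open HCLevi

/-! ### 1. The matrix height along `diag(m, 1)` and `diag(1, m)` -/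

section MatrixHeight

variable {R : Type*} [NormedCommRing R] {k l : ℕ}

/-- **The matrix height of `diag(a, 1)`** is at most that of `a`, up to `‖1‖`: every entry of
`diag(a, 1)^{±1}` is an entry of `a^{±1}`, or `0`, or `1`. [folklore] -/
theorem sup_nnnorm_leviGL_inl_le (a : GL (Fin k) R) :
    (Finset.univ.sup fun ij : Fin (k + l) × Fin (k + l) =>
        ‖((leviGL R k l (a, 1) : GL (Fin (k + l)) R) : Matrix _ _ R) ij.1 ij.2‖₊ ⊔
          ‖(((leviGL R k l (a, 1))⁻¹ : GL (Fin (k + l)) R) : Matrix _ _ R) ij.1 ij.2‖₊) ≤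
      (Finset.univ.sup fun ij : Fin k × Fin k =>
        ‖(a : Matrix (Fin k) (Fin k) R) ij.1 ij.2‖₊ ⊔ ‖((a⁻¹ : GL (Fin k) R) : Matrix (Fin k) (Fin k) R) ij.1 ij.2‖₊) ⊔
        ‖(1 : R)‖₊ := by
  refine Finset.sup_le fun ij _ => ?_
  obtain ⟨i, j⟩ := ij
  rw [coe_leviGL_inv, coe_leviGL]
  simp only [inv_one, Units.val_one]
  induction i using Fin.addCases with
  | left i =>
    induction j using Fin.addCases with
    | left j =>
      rw [blockDiag'_castAdd_castAdd, blockDiag'_castAdd_castAdd]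
      exact le_sup_of_le_left (sup_le (nnnorm_apply_le_sup a i j) (nnnorm_inv_apply_le_sup a i j))
    | right j =>
      rw [blockDiag'_castAdd_natAdd, blockDiag'_castAdd_natAdd, nnnorm_zero, sup_idem]
      exact bot_le
  | right i =>
    induction j using Fin.addCases with
    | left j =>
      rw [blockDiag'_natAdd_castAdd, blockDiag'_natAdd_castAdd, nnnorm_zero, sup_idem]
      exact bot_le
    | right j =>
      rw [blockDiag'_natAdd_natAdd, blockDiag'_natAdd_natAdd, sup_idem, Matrix.one_apply]
      split_ifs
      · exact le_sup_right
      · rw [nnnorm_zero]; exact bot_le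

/-- **The matrix height of `diag(1, d)`** is at most that of `d`, up to `‖1‖`. [folklore] -/
theorem sup_nnnorm_leviGL_inr_le (d : GL (Fin l) R) :
    (Finset.univ.sup fun ij : Fin (k + l) × Fin (k + l) =>
        ‖((leviGL R k l (1, d) : GL (Fin (k + l)) R) : Matrix _ _ R) ij.1 ij.2‖₊ ⊔
          ‖(((leviGL R k l (1, d))⁻¹ : GL (Fin (k + l)) R) : Matrix _ _ R) ij.1 ij.2‖₊) ≤
      (Finset.univ.sup fun ij : Fin l × Fin l =>
        ‖(d : Matrix (Fin l) (Fin l) R) ij.1 ij.2‖₊ ⊔ ‖((d⁻¹ : GL (Fin l) R) : Matrix (Fin l) (Fin l) R) ij.1 ij.2‖₊) ⊔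
        ‖(1 : R)‖₊ := by
  refine Finset.sup_le fun ij _ => ?_
  obtain ⟨i, j⟩ := ij
  rw [coe_leviGL_inv, coe_leviGL]
  simp only [inv_one, Units.val_one]
  induction i using Fin.addCases with
  | left i =>
    induction j using Fin.addCases with
    | left j =>
      rw [blockDiag'_castAdd_castAdd, blockDiag'_castAdd_castAdd, sup_idem, Matrix.one_apply]
      split_ifs
      · exact le_sup_right
      · rw [nnnorm_zero]; exact bot_le
    | right j =>
      rw [blockDiag'_castAdd_natAdd, blockDiag'_castAdd_natAdd, nnnorm_zero, sup_idem]
      exact bot_le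
  | right i =>
    induction j using Fin.addCases with
    | left j =>
      rw [blockDiag'_natAdd_castAdd, blockDiag'_natAdd_castAdd, nnnorm_zero, sup_idem]
      exact bot_le
    | right j =>
      rw [blockDiag'_natAdd_natAdd, blockDiag'_natAdd_natAdd]
      exact le_sup_of_le_left (sup_le (nnnorm_apply_le_sup d i j) (nnnorm_inv_apply_le_sup d i j))

end MatrixHeight

/-! ### 2. The local and archimedean heights along the Levi -/

section Heights

variable {K : Type} [Field K] [NumberField K] {k l : ℕ}

/-- `H_∞(diag(m, 1)) ≤ H_∞(m) ⊔ 1` (`‖1‖ ≤ 1` in `K_∞ = mixedSpace K`). [cite: BorelJacquet1979, §1.2] -/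
theorem GLn.archHeight_leviGL_inl_le (m : GL (Fin k) (AdeleRing (𝓞 K) K)) :
    GLn.archHeight (k + l) K (leviGL (AdeleRing (𝓞 K) K) k l (m, 1)) ≤ GLn.archHeight k K m ⊔ 1 := by
  unfold GLn.archHeight
  rw [GLn.toMixed_leviGL]
  simp only [map_one]
  refine (sup_nnnorm_leviGL_inl_le _).trans (sup_le_sup_left ?_ _)
  exact_mod_cast (norm_one_mixedSpace_le (K := K))

/-- `H_∞(diag(1, m)) ≤ H_∞(m) ⊔ 1`. [cite: BorelJacquet1979, §1.2] -/
theorem GLn.archHeight_leviGL_inr_le (m : GL (Fin l) (AdeleRing (𝓞 K) K)) :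
    GLn.archHeight (k + l) K (leviGL (AdeleRing (𝓞 K) K) k l (1, m)) ≤ GLn.archHeight l K m ⊔ 1 := by
  unfold GLn.archHeight
  rw [GLn.toMixed_leviGL]
  simp only [map_one]
  refine (sup_nnnorm_leviGL_inr_le _).trans (sup_le_sup_left ?_ _)
  exact_mod_cast (norm_one_mixedSpace_le (K := K))

/-- `H_v(diag(m, 1)) ≤ H_v(m)` at a finite place (`‖1‖_v = 1 ≤ H_v(m)`, `k ≥ 1`).
[cite: BorelJacquet1979, §1.2] -/
theorem GLn.localHeight_leviGL_inl_le [NeZero k] (v : HeightOneSpectrum (𝓞 K)) (m : GL (Fin k) (AdeleRing (𝓞 K) K)) :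
    GLn.localHeight (k + l) K v (leviGL (AdeleRing (𝓞 K) K) k l (m, 1)) ≤ GLn.localHeight k K v m := by
  have h1 : (1 : ℝ≥0) ≤ GLn.localHeight k K v m := GLn.one_le_localHeight v m
  unfold GLn.localHeight
  rw [leviGL_map, map_one]
  refine (sup_nnnorm_leviGL_inl_le _).trans (sup_le le_rfl ?_)
  rw [nnnorm_one]
  exact h1

/-- `H_v(diag(1, m)) ≤ H_v(m)` at a finite place (`l ≥ 1`). [cite: BorelJacquet1979, §1.2] -/
theorem GLn.localHeight_leviGL_inr_le [NeZero l] (v : HeightOneSpectrum (𝓞 K)) (m : GL (Fin l) (AdeleRing (𝓞 K) K)) :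
    GLn.localHeight (k + l) K v (leviGL (AdeleRing (𝓞 K) K) k l (1, m)) ≤ GLn.localHeight l K v m := by
  have h1 : (1 : ℝ≥0) ≤ GLn.localHeight l K v m := GLn.one_le_localHeight v m
  unfold GLn.localHeight
  rw [leviGL_map, map_one]
  refine (sup_nnnorm_leviGL_inr_le _).trans (sup_le le_rfl ?_)
  rw [nnnorm_one]
  exact h1

/-- The local heights have finite multiplicative support (real-valued form). [folklore] -/
theorem GLn.hasFiniteMulSupport_localHeight {m : ℕ} [NeZero m] (g : GL (Fin m) (AdeleRing (𝓞 K) K)) :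
    Function.HasFiniteMulSupport fun v => (GLn.localHeight m K v g : ℝ) := by
  refine (GLn.mulSupport_localHeight_finite_holds g).subset fun v hv => ?_
  simpa [Function.mem_mulSupport] using hv

/-- `∏_v H_v(diag(m, 1)) ≤ ∏_v H_v(m)`. [cite: BorelJacquet1979, §1.2] -/
theorem GLn.finprod_localHeight_leviGL_inl_le [NeZero k] (m : GL (Fin k) (AdeleRing (𝓞 K) K)) :
    ∏ᶠ v, (GLn.localHeight (k + l) K v (leviGL (AdeleRing (𝓞 K) K) k l (m, 1)) : ℝ) ≤
      ∏ᶠ v, (GLn.localHeight k K v m : ℝ) := by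
  haveI : NeZero (k + l) := ⟨fun h => NeZero.ne k (by omega)⟩
  refine finprod_le_finprod (GLn.hasFiniteMulSupport_localHeight _) (fun _ => NNReal.coe_nonneg _)
    (GLn.hasFiniteMulSupport_localHeight m) fun v => ?_
  exact_mod_cast GLn.localHeight_leviGL_inl_le (l := l) v m

/-- `∏_v H_v(diag(1, m)) ≤ ∏_v H_v(m)`. [cite: BorelJacquet1979, §1.2] -/
theorem GLn.finprod_localHeight_leviGL_inr_le [NeZero l] (m : GL (Fin l) (AdeleRing (𝓞 K) K)) :
    ∏ᶠ v, (GLn.localHeight (k + l) K v (leviGL (AdeleRing (𝓞 K) K) k l (1, m)) : ℝ) ≤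
      ∏ᶠ v, (GLn.localHeight l K v m : ℝ) := by
  haveI : NeZero (k + l) := ⟨fun h => NeZero.ne l (by omega)⟩
  refine finprod_le_finprod (GLn.hasFiniteMulSupport_localHeight _) (fun _ => NNReal.coe_nonneg _)
    (GLn.hasFiniteMulSupport_localHeight m) fun v => ?_
  exact_mod_cast GLn.localHeight_leviGL_inr_le (k := k) v m

/-- **`1 ≤ n H_∞(g)²`** for `g ∈ GL_n(𝔸_K)`, `n ≥ 1`: `1 = ‖1‖ = ‖∑_j (g_∞)_{1j} (g_∞⁻¹)_{j1}‖ ≤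
∑_j ‖(g_∞)_{1j}‖ ‖(g_∞⁻¹)_{j1}‖ ≤ n H_∞(g)²` (`‖1‖ ≥ 1` in the non-trivial normed ring `K_∞`).
[cite: BorelJacquet1979, §1.2] -/
theorem GLn.one_le_mul_archHeight_sq {m : ℕ} [NeZero m] (g : GL (Fin m) (AdeleRing (𝓞 K) K)) :
    (1 : ℝ) ≤ m * (GLn.archHeight m K g : ℝ) ^ 2 := by
  set x : GL (Fin m) (mixedSpace K) := GLn.toMixed m K g with hx
  set i₀ : Fin m := ⟨0, Nat.pos_of_ne_zero (NeZero.ne m)⟩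
  have hentry : ∀ i j, ‖(x : Matrix (Fin m) (Fin m) (mixedSpace K)) i j‖ ≤ GLn.archHeight m K g := fun i j => by
    exact_mod_cast nnnorm_apply_le_sup x i j
  have hinv : ∀ i j, ‖((x⁻¹ : GL (Fin m) (mixedSpace K)) : Matrix (Fin m) (Fin m) (mixedSpace K)) i j‖ ≤
      GLn.archHeight m K g := fun i j => by
    exact_mod_cast nnnorm_inv_apply_le_sup x i j
  have hmul : ((x : Matrix (Fin m) (Fin m) (mixedSpace K)) *
      ((x⁻¹ : GL (Fin m) (mixedSpace K)) : Matrix (Fin m) (Fin m) (mixedSpace K))) i₀ i₀ = 1 := by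
    rw [← Units.val_mul, mul_inv_cancel, Units.val_one, Matrix.one_apply_eq]
  have hnorm1 : (1 : ℝ) ≤ ‖(1 : mixedSpace K)‖ := one_le_norm_one (mixedSpace K)
  calc (1 : ℝ) ≤ ‖(1 : mixedSpace K)‖ := hnorm1
    _ = ‖∑ j, (x : Matrix (Fin m) (Fin m) (mixedSpace K)) i₀ j *
          ((x⁻¹ : GL (Fin m) (mixedSpace K)) : Matrix (Fin m) (Fin m) (mixedSpace K)) j i₀‖ := by
        rw [← hmul, Matrix.mul_apply]
    _ ≤ ∑ j, ‖(x : Matrix (Fin m) (Fin m) (mixedSpace K)) i₀ j *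
          ((x⁻¹ : GL (Fin m) (mixedSpace K)) : Matrix (Fin m) (Fin m) (mixedSpace K)) j i₀‖ := norm_sum_le _ _
    _ ≤ ∑ _j : Fin m, (GLn.archHeight m K g : ℝ) * GLn.archHeight m K g :=
        Finset.sum_le_sum fun j _ => (norm_mul_le _ _).trans
          (mul_le_mul (hentry i₀ j) (hinv j i₀) (norm_nonneg _) (NNReal.coe_nonneg _))
    _ = m * (GLn.archHeight m K g : ℝ) ^ 2 := by
        rw [Finset.sum_const, Finset.card_univ, Fintype.card_fin, nsmul_eq_mul, sq]

/-- The elementary inequality behind the comparison: for `a ≥ 0`, `P ≥ 1`, `c ≥ 1` with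
`1 ≤ c a²`, one has `(a ⊔ 1) P ≤ c (1 ⊔ a P)`. [folklore] -/
theorem sup_one_mul_le_of_one_le_mul_sq {a P c : ℝ} (ha : 0 ≤ a) (hP : 1 ≤ P) (hc : 1 ≤ c)
    (h : 1 ≤ c * a ^ 2) : (a ⊔ 1) * P ≤ c * (1 ⊔ a * P) := by
  have hP0 : 0 ≤ P := zero_le_one.trans hP
  rcases le_or_gt 1 a with ha1 | ha1
  · rw [sup_eq_left.2 ha1]
    calc a * P ≤ 1 ⊔ a * P := le_sup_right
      _ ≤ c * (1 ⊔ a * P) := le_mul_of_one_le_left (zero_le_one.trans le_sup_left) hc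
  · rw [sup_eq_right.2 ha1.le]
    have h2 : a ^ 2 ≤ a := by
      rw [sq]
      exact mul_le_of_le_one_left ha ha1.le
    have h3 : 1 ≤ c * a := h.trans (mul_le_mul_of_nonneg_left h2 (zero_le_one.trans hc))
    calc 1 * P ≤ c * a * P := mul_le_mul_of_nonneg_right h3 hP0
      _ = c * (a * P) := by ring
      _ ≤ c * (1 ⊔ a * P) := mul_le_mul_of_nonneg_left le_sup_right (zero_le_one.trans hc)

/-- **`1 ⊔ ‖diag(m, 1)‖ ≤ k (1 ⊔ ‖m‖)`** for `m ∈ GL_k(𝔸_K)`, `k ≥ 1` (adelic heights of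
`AdelicGLnGlue` on `GL_{k+l}` and `GL_k`). [cite: BorelJacquet1979, §1.2] -/
theorem one_sup_adelicHeightGL_leviGL_inl_le [NeZero k] (m : GL (Fin k) (AdeleRing (𝓞 K) K)) :
    1 ⊔ adelicHeightGL (k + l) K (leviGL (AdeleRing (𝓞 K) K) k l (m, 1)) ≤
      k * (1 ⊔ adelicHeightGL k K m) := by
  have hk : (1 : ℝ) ≤ k := by exact_mod_cast Nat.one_le_iff_ne_zero.2 (NeZero.ne k)
  set a : ℝ := ((GLn.archHeight k K m : ℝ≥0) : ℝ) with ha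
  set P : ℝ := ∏ᶠ v, (GLn.localHeight k K v m : ℝ) with hP
  have ha0 : 0 ≤ a := NNReal.coe_nonneg _
  have hP1 : 1 ≤ P := GLn.one_le_finprod_localHeight m
  have hsq : 1 ≤ (k : ℝ) * a ^ 2 := GLn.one_le_mul_archHeight_sq m
  -- the height of `diag(m, 1)`
  have hH : adelicHeightGL (k + l) K (leviGL (AdeleRing (𝓞 K) K) k l (m, 1)) ≤ (a ⊔ 1) * P := by
    unfold adelicHeightGL
    refine mul_le_mul ?_ (GLn.finprod_localHeight_leviGL_inl_le m) ?_ (le_sup_of_le_right zero_le_one)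
    · have := GLn.archHeight_leviGL_inl_le (l := l) m
      calc (GLn.archHeight (k + l) K (leviGL (AdeleRing (𝓞 K) K) k l (m, 1)) : ℝ)
          ≤ ((GLn.archHeight k K m ⊔ 1 : ℝ≥0) : ℝ) := by exact_mod_cast this
        _ = a ⊔ 1 := by rw [NNReal.coe_max, NNReal.coe_one]
    · haveI : NeZero (k + l) := ⟨fun h => NeZero.ne k (by omega)⟩
      exact zero_le_one.trans (GLn.one_le_finprod_localHeight _)
  have key := sup_one_mul_le_of_one_le_mul_sq ha0 hP1 hk hsq
  have hkm : (1 : ℝ) ≤ k * (1 ⊔ a * P) := by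
    calc (1 : ℝ) ≤ 1 ⊔ a * P := le_sup_left
      _ ≤ k * (1 ⊔ a * P) := le_mul_of_one_le_left (zero_le_one.trans le_sup_left) hk
  change 1 ⊔ adelicHeightGL (k + l) K _ ≤ k * (1 ⊔ a * P)
  exact sup_le hkm (hH.trans key)

/-- **`1 ⊔ ‖diag(1, m)‖ ≤ l (1 ⊔ ‖m‖)`** for `m ∈ GL_l(𝔸_K)`, `l ≥ 1`. [cite: BorelJacquet1979, §1.2] -/
theorem one_sup_adelicHeightGL_leviGL_inr_le [NeZero l] (m : GL (Fin l) (AdeleRing (𝓞 K) K)) :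
    1 ⊔ adelicHeightGL (k + l) K (leviGL (AdeleRing (𝓞 K) K) k l (1, m)) ≤
      l * (1 ⊔ adelicHeightGL l K m) := by
  have hl : (1 : ℝ) ≤ l := by exact_mod_cast Nat.one_le_iff_ne_zero.2 (NeZero.ne l)
  set a : ℝ := ((GLn.archHeight l K m : ℝ≥0) : ℝ) with ha
  set P : ℝ := ∏ᶠ v, (GLn.localHeight l K v m : ℝ) with hP
  have ha0 : 0 ≤ a := NNReal.coe_nonneg _
  have hP1 : 1 ≤ P := GLn.one_le_finprod_localHeight m
  have hsq : 1 ≤ (l : ℝ) * a ^ 2 := GLn.one_le_mul_archHeight_sq m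
  have hH : adelicHeightGL (k + l) K (leviGL (AdeleRing (𝓞 K) K) k l (1, m)) ≤ (a ⊔ 1) * P := by
    unfold adelicHeightGL
    refine mul_le_mul ?_ (GLn.finprod_localHeight_leviGL_inr_le m) ?_ (le_sup_of_le_right zero_le_one)
    · have := GLn.archHeight_leviGL_inr_le (k := k) m
      calc (GLn.archHeight (k + l) K (leviGL (AdeleRing (𝓞 K) K) k l (1, m)) : ℝ)
          ≤ ((GLn.archHeight l K m ⊔ 1 : ℝ≥0) : ℝ) := by exact_mod_cast this
        _ = a ⊔ 1 := by rw [NNReal.coe_max, NNReal.coe_one]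
    · haveI : NeZero (k + l) := ⟨fun h => NeZero.ne l (by omega)⟩
      exact zero_le_one.trans (GLn.one_le_finprod_localHeight _)
  have key := sup_one_mul_le_of_one_le_mul_sq ha0 hP1 hl hsq
  have hlm : (1 : ℝ) ≤ l * (1 ⊔ a * P) := by
    calc (1 : ℝ) ≤ 1 ⊔ a * P := le_sup_left
      _ ≤ l * (1 ⊔ a * P) := le_mul_of_one_le_left (zero_le_one.trans le_sup_left) hl
  change 1 ⊔ adelicHeightGL (k + l) K _ ≤ l * (1 ⊔ a * P)
  exact sup_le hlm (hH.trans key)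

/-- `1 ⊔ c x ≤ c (1 ⊔ x)` for `c ≥ 1`. [folklore] -/
theorem one_sup_mul_le_mul_one_sup {c x : ℝ} (hc : 1 ≤ c) : 1 ⊔ c * x ≤ c * (1 ⊔ x) :=
  sup_le (one_le_mul_of_one_le_of_one_le hc le_sup_left)
    (mul_le_mul_of_nonneg_left le_sup_right (zero_le_one.trans hc))

/-- **The height on the Levi is polynomially bounded by the heights of the factors**:
`1 ⊔ ‖diag(m₁, m₂)‖ ≤ (k + l) k l (1 ⊔ ‖m₁‖) (1 ⊔ ‖m₂‖)` (`k, l ≥ 1`; the tree's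
`one_sup_adelicHeightGL_mul_le` for `diag(m₁, m₂) = diag(m₁, 1) diag(1, m₂)`). Moeglin–Waldspurger
1995, I.2.2. [cite: MoeglinWaldspurger1995, I.2.2] -/
theorem one_sup_adelicHeightGL_leviGL_le [NeZero k] [NeZero l]
    (m₁ : GL (Fin k) (AdeleRing (𝓞 K) K)) (m₂ : GL (Fin l) (AdeleRing (𝓞 K) K)) :
    1 ⊔ adelicHeightGL (k + l) K (leviGL (AdeleRing (𝓞 K) K) k l (m₁, m₂)) ≤
      ((k + l : ℕ) * k * l : ℝ) * (1 ⊔ adelicHeightGL k K m₁) * (1 ⊔ adelicHeightGL l K m₂) := by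
  have hkl : (1 : ℝ) ≤ (k + l : ℕ) := by
    exact_mod_cast Nat.one_le_iff_ne_zero.2 (fun h => NeZero.ne k (by omega))
  rw [leviGL_eq_inl_mul_inr]
  refine (one_sup_adelicHeightGL_mul_le _ _).trans ?_
  have h1 := one_sup_adelicHeightGL_leviGL_inl_le (l := l) m₁
  have h2 := one_sup_adelicHeightGL_leviGL_inr_le (k := k) m₂
  have h3 : 1 ⊔ ((k + l : ℕ) : ℝ) * adelicHeightGL (k + l) K (leviGL (AdeleRing (𝓞 K) K) k l (1, m₂)) ≤
      ((k + l : ℕ) : ℝ) * (l * (1 ⊔ adelicHeightGL l K m₂)) :=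
    (one_sup_mul_le_mul_one_sup hkl).trans
      (mul_le_mul_of_nonneg_left h2 (zero_le_one.trans hkl))
  have h10 : (0 : ℝ) ≤ 1 ⊔ adelicHeightGL (k + l) K (leviGL (AdeleRing (𝓞 K) K) k l (m₁, 1)) :=
    zero_le_one.trans le_sup_left
  have hl0 : (0 : ℝ) ≤ ((k + l : ℕ) : ℝ) * (l * (1 ⊔ adelicHeightGL l K m₂)) := by positivity
  calc (1 ⊔ ((k + l : ℕ) : ℝ) * adelicHeightGL (k + l) K (leviGL (AdeleRing (𝓞 K) K) k l (1, m₂))) *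
        (1 ⊔ adelicHeightGL (k + l) K (leviGL (AdeleRing (𝓞 K) K) k l (m₁, 1)))
      ≤ (((k + l : ℕ) : ℝ) * (l * (1 ⊔ adelicHeightGL l K m₂))) * (k * (1 ⊔ adelicHeightGL k K m₁)) :=
        mul_le_mul h3 h1 h10 hl0
    _ = ((k + l : ℕ) * k * l : ℝ) * (1 ⊔ adelicHeightGL k K m₁) * (1 ⊔ adelicHeightGL l K m₂) := by ring

end Heights

end Literature.NumberTheory.Automorphic
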